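import Summits.QuantumFields.YangMills.Theorems.UnitScaleTiltHalvingP1FlatCorePreGauge
import Literature.MathematicalPhysics.QuantumFieldTheory.Balaban1983to89.B8Lemma1NonAbelian
import HarnessLib

/-!
# Line H (`BirthV10.stub_halvingStep`, stmt-QuantumFields-19200) — (M2′) toolbox, ℤᵈ side: ★★ NON-ABELIAN STOKES FOR A TREE-AXIAL FIELD ON A BOX
# («complete axial gauge rooted at `lo` + plaquettes within `p` ⇒ every in-box bond within `|hi − lo|₁·p` of `1` ⇒ every axial transport between two box points
# within `|z − y|₁·|hi − lo|₁·p` of `1`», both orientations)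

Cell `ym3-torus` (HUMAN RULING D-0037: YM₃ on T³ is ladder rung R3 — NOT d = 4, NOT infinite volume, NOT a mass gap, NOT the Clay problem), width seat `ym-ust-19200-w3` gen 10
(LEAD-H ★w5-19200 g7 WORD 1 (C) «STOKES θ-SUPPLIER», option (S-a) of my LOCATE «STOKES θ-SUPPLIER — CURRENCY AUDIT», 19200 evidence #44).  `--supports stmt-QuantumFields-19200
--as helper`; THEOREMS ONLY (0 `def`, 0 `sorry`); count-neutral; nothing here claims the collar socket `H42topCrossT`, (M2′), the stub, the crux or the gap.

WHAT.  Pure `ℤᵈ` lattice-gauge bookkeeping over [Balaban1985Averaging] pp. 24–25 as typed in lit `B8Lemma1NonAbelian` (`axial_bond_bound_sharp`, `tw_walk`, `seg_walk`), for a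
`U1`-valued bond field `W` on a box `[lo, hi] ⊂ ℤᵈ` that is TREE-AXIAL AT `lo` — `W x ν = 1` on every bond of the lexicographic comb rooted at `lo` (`lowPart ν (x − lo) = 0`), the
shape of J3's row (c′) (✓`P1FlatCorePreGauge.exists_preGauge_flat` conjunct 5, re-exported as guard (R3) of the v3.2 collar socket by ✓p687574∕✓p687794) — with plaquettes within `p`
on the box (`PlaqSmall W lo hi p`):
* §1 ★ `axialFn_eq_one_of_treeAxial` — the comb transporter from the root is trivial: `axialFn W lo x = 1` for `x ∈ [lo, hi]` (`tw_walk` with zero budget); hence the field IS its own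
  axial gauge on the box: `gaugeAct_axialFn_eq_of_treeAxial`.
* §2 ★★ `norm_bond_sub_one_le_of_treeAxial` — EVERY in-box bond: `‖W x μ − 1‖ ≤ |lowPart μ (x − lo)|₁·p ≤ |hi − lo|₁·p` (`axial_bond_bound_sharp` read through §1).
* §3 walks of either orientation inside the box under a uniform in-box bond bound `b` (`seg_walk_fwd∕_bwd∕_int`, `tw_walk_box`; the comb path between two box points stays in
  the box), and ★★★ `norm_axialFn_sub_one_le_of_treeAxial` — for ANY two box points `y, z` (no sign condition on `z − y`):
  `‖axialFn W y z − 1‖ ≤ |z − y|₁ · (|hi − lo|₁ · p)`.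
CURRENCY NOTE (the point of the LOCATE).  The lemma is generic in `p`.  Read on the COMB top average `Ũ♯ = avgIter (pull (U^{gJ})) (K − n)` of the H lane ((R3)'s object) the tree
supplies only `p = O(ε₀)` (lit ✓`B7AvgGaugeCovariance.pdev_avgIter_lt_two_alpha`), which makes the right side quadratic in the box size × `ε₀` — too weak for the (1.42) collar window;
the ε₁-flat top average is the torus double-bar one.  So this file is the comb-world geometric core only, NOT the θ-supplier; see the memo for what (M2′) needs in addition.
HONEST SCOPE.  Elementary; no analytic content beyond lit `B8Lemma1NonAbelian`; nothing of Prop. 3∕5, Theorem 4, (M2′) or the stub is proved here.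

References: T. Bałaban, CMP **98** (1985) 17–51 [Balaban1985Averaging] (pp. 24–25 (the tree gauge and its bond bound), (21)–(23) p.21); CMP **99** (1985) 75–102
[Balaban1985RegularSpaces] ((1.19) p.79, Lemma 1 (1.25) p.79, (1.42) p.83).
-/

set_option autoImplicit false

noncomputable section

namespace Summit.QuantumFields.YangMills.Theorems.HalvingTreeAxialStokes

open Literature.MathematicalPhysics.QuantumFieldTheory.Balaban1983to89
open B7Prop1Explicit (Site e e_apply Letter hol hol_nil hol_cons hol_append stepHol stepHol_true stepHol_false seg seg_natCast treeWord disp disp_seg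
  axialFn gaugeAct l1 U1 mem_U1 hol_mem norm_inv_sub_one_le)
open B8Lemma1NonAbelian (lowPart PlaqSmall tw tw_cons tw_nil treeWord_eq_tw tw_walk axial_bond_bound_sharp zsmul_e_apply zsmul_e_nonneg e_nonneg
  pairwise_gt_finRange_reverse)
open Summit.QuantumFields.YangMills.Theorems.P1FlatCorePreGauge (l1_lowPart_sub_le)

variable {d : ℕ} {𝔸 : Type*} [NormedRing 𝔸] [NormOneClass 𝔸]

/-! ## §1 A tree-axial field is its own axial gauge on the box -/

/-- ★ **The comb transporter from the root is trivial**: if `W = 1` on every bond of the `lo`-rooted comb inside `[lo, hi]`, then `W(Γ_{lo,x}) = 1` for every box point `x`.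
[cite: Balaban1985Averaging, p.24] -/
theorem axialFn_eq_one_of_treeAxial (W : Site d → Fin d → 𝔸ˣ) (hW : ∀ x κ, W x κ ∈ U1 𝔸) {lo hi : Site d}
    (hT : ∀ (x : Site d) (ν : Fin d), lo ≤ x → x + e ν ≤ hi → lowPart ν (x - lo) = 0 → W x ν = 1)
    {x : Site d} (hlo : lo ≤ x) (hhi : x ≤ hi) : axialFn W lo x = 1 := by
  have hx : lo + (x - lo) = x := by abel
  have h := tw_walk W hW (fun _ => (0 : ℝ)) (List.finRange d).reverse (pairwise_gt_finRange_reverse d) (x - lo) (sub_nonneg.mpr hlo) lo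
    (fun κ _ z hz1 hz2 hz3 => by
      rw [hx] at hz2
      rw [hT z κ hz1 (hz2.trans hhi) hz3, Units.val_one, sub_self, norm_zero])
  have h0 : ((List.finRange d).reverse.map fun κ => (((x - lo) κ).natAbs : ℝ) * 0).sum = 0 := by
    simp only [mul_zero, List.map_const', List.sum_replicate, smul_zero]
  rw [← treeWord_eq_tw, h0] at h
  have h1 : ((hol W lo (treeWord (x - lo)) : 𝔸ˣ) : 𝔸) - 1 = 0 := norm_le_zero_iff.mp h
  exact Units.val_eq_one.mp (sub_eq_zero.mp h1)

/-- On the box, a tree-axial field coincides with its own axial-gauge transform `W^{v₀}`, `v₀ = W(Γ_{lo,·})`. [cite: Balaban1985Averaging, p.24] -/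
theorem gaugeAct_axialFn_eq_of_treeAxial (W : Site d → Fin d → 𝔸ˣ) (hW : ∀ x κ, W x κ ∈ U1 𝔸) {lo hi : Site d}
    (hT : ∀ (x : Site d) (ν : Fin d), lo ≤ x → x + e ν ≤ hi → lowPart ν (x - lo) = 0 → W x ν = 1)
    {x : Site d} {μ : Fin d} (hlo : lo ≤ x) (hhi : x + e μ ≤ hi) : gaugeAct (axialFn W lo) W x μ = W x μ := by
  have hxhi : x ≤ hi := le_trans (le_add_of_nonneg_right (e_nonneg μ)) hhi
  have hlo' : lo ≤ x + e μ := le_trans hlo (le_add_of_nonneg_right (e_nonneg μ))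
  show axialFn W lo x * W x μ * (axialFn W lo (x + e μ))⁻¹ = W x μ
  rw [axialFn_eq_one_of_treeAxial W hW hT hlo hxhi, axialFn_eq_one_of_treeAxial W hW hT hlo' hhi, inv_one, one_mul, mul_one]

/-! ## §2 Every in-box bond of a tree-axial field with small plaquettes is near `1` -/

/-- ★★ **The bond bound in the tree gauge, for a field that is ALREADY tree-axial** ([Balaban1985Averaging] p.24 l.−2 – p.25 l.3, lit ✓`axial_bond_bound_sharp` read through §1):
`‖W(x, x+e_μ) − 1‖ ≤ |lowPart μ (x − lo)|₁ · p`. [cite: Balaban1985Averaging, pp.24–25] -/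
theorem norm_bond_sub_one_le_of_treeAxial (W : Site d → Fin d → 𝔸ˣ) (hW : ∀ x κ, W x κ ∈ U1 𝔸) {lo hi : Site d} {p : ℝ} (hP : PlaqSmall W lo hi p)
    (hT : ∀ (x : Site d) (ν : Fin d), lo ≤ x → x + e ν ≤ hi → lowPart ν (x - lo) = 0 → W x ν = 1)
    (x : Site d) (μ : Fin d) (hlo : lo ≤ x) (hhi : x + e μ ≤ hi) :
    ‖((W x μ : 𝔸ˣ) : 𝔸) - 1‖ ≤ l1 (lowPart μ (x - lo)) * p := by
  have hb := axial_bond_bound_sharp W hW hP lo x μ le_rfl hlo hhi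
  rwa [gaugeAct_axialFn_eq_of_treeAxial W hW hT hlo hhi] at hb

/-- The same with the uniform constant `|hi − lo|₁ · p`. [cite: Balaban1985Averaging, pp.24–25] -/
theorem norm_bond_sub_one_le_of_treeAxial' (W : Site d → Fin d → 𝔸ˣ) (hW : ∀ x κ, W x κ ∈ U1 𝔸) {lo hi : Site d} {p : ℝ} (hp : 0 ≤ p) (hP : PlaqSmall W lo hi p)
    (hT : ∀ (x : Site d) (ν : Fin d), lo ≤ x → x + e ν ≤ hi → lowPart ν (x - lo) = 0 → W x ν = 1)
    (x : Site d) (μ : Fin d) (hlo : lo ≤ x) (hhi : x + e μ ≤ hi) :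
    ‖((W x μ : 𝔸ˣ) : 𝔸) - 1‖ ≤ l1 (hi - lo) * p :=
  (norm_bond_sub_one_le_of_treeAxial W hW hP hT x μ hlo hhi).trans
    (mul_le_mul_of_nonneg_right (by exact_mod_cast l1_lowPart_sub_le μ hlo hhi) hp)

/-! ## §3 Walks of either orientation inside the box, and the transport bound -/

/-- Forward segment walk inside the box under a uniform in-box bond bound: `‖W([q, q + m e_κ]) − 1‖ ≤ m·b`. [folklore] -/
theorem seg_walk_fwd (W : Site d → Fin d → 𝔸ˣ) (hW : ∀ x κ, W x κ ∈ U1 𝔸) {lo hi : Site d} {b : ℝ}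
    (hB : ∀ (z : Site d) (κ : Fin d), lo ≤ z → z + e κ ≤ hi → ‖((W z κ : 𝔸ˣ) : 𝔸) - 1‖ ≤ b) (κ : Fin d) :
    ∀ (m : ℕ) (q : Site d), lo ≤ q → q + (m : ℤ) • e κ ≤ hi → ‖((hol W q (List.replicate m (κ, true)) : 𝔸ˣ) : 𝔸) - 1‖ ≤ m * b
  | 0, q, _, _ => by simp
  | m + 1, q, hq, hqm => by
    have hstep : q + e κ ≤ q + ((m + 1 : ℕ) : ℤ) • e κ := fun i => by
      simp only [Pi.add_apply, zsmul_e_apply, e_apply]; split_ifs <;> push_cast <;> omega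
    have hq1 : q + e κ + (m : ℤ) • e κ = q + ((m + 1 : ℕ) : ℤ) • e κ := by
      funext i; simp only [Pi.add_apply, zsmul_e_apply, e_apply]; split_ifs <;> push_cast <;> ring
    rw [List.replicate_succ, hol_cons, stepHol_true, Units.val_mul, Nat.cast_succ, add_mul, one_mul, add_comm (↑m * b)]
    have h1 : ‖((W q κ : 𝔸ˣ) : 𝔸)‖ ≤ 1 := (mem_U1.mp (hW q κ)).1
    refine (B8Ineq170.norm_mul_sub_one_le_of_norm_le_one h1).trans (add_le_add (hB q κ hq (hstep.trans hqm)) ?_)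
    have hq' : lo ≤ q + e κ := hq.trans (le_add_of_nonneg_right (e_nonneg κ))
    have := seg_walk_fwd W hW hB κ m (q + e κ) hq' (by rw [hq1]; exact hqm)
    simpa only [B7Prop1Explicit.Letter.vec_true] using this

/-- Backward segment walk inside the box: `‖W([q, q − m e_κ]) − 1‖ ≤ m·b` (each step is an inverse bond variable, `‖u⁻¹ − 1‖ ≤ ‖u − 1‖` in `U1`). [folklore] -/
theorem seg_walk_bwd (W : Site d → Fin d → 𝔸ˣ) (hW : ∀ x κ, W x κ ∈ U1 𝔸) {lo hi : Site d} {b : ℝ}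
    (hB : ∀ (z : Site d) (κ : Fin d), lo ≤ z → z + e κ ≤ hi → ‖((W z κ : 𝔸ˣ) : 𝔸) - 1‖ ≤ b) (κ : Fin d) :
    ∀ (m : ℕ) (q : Site d), lo ≤ q - (m : ℤ) • e κ → q ≤ hi → ‖((hol W q (List.replicate m (κ, false)) : 𝔸ˣ) : 𝔸) - 1‖ ≤ m * b
  | 0, q, _, _ => by simp
  | m + 1, q, hqm, hq => by
    have hstep : q - ((m + 1 : ℕ) : ℤ) • e κ ≤ q - e κ := fun i => by
      simp only [Pi.sub_apply, zsmul_e_apply, e_apply]; split_ifs <;> push_cast <;> omega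
    have hq1 : q - e κ - (m : ℤ) • e κ = q - ((m + 1 : ℕ) : ℤ) • e κ := by
      funext i; simp only [Pi.sub_apply, zsmul_e_apply, e_apply]; split_ifs <;> push_cast <;> ring
    rw [List.replicate_succ, hol_cons, stepHol_false, Units.val_mul, Nat.cast_succ, add_mul, one_mul, add_comm (↑m * b)]
    have h1 : ‖(((W (q - e κ) κ)⁻¹ : 𝔸ˣ) : 𝔸)‖ ≤ 1 := (mem_U1.mp (hW (q - e κ) κ)).2
    refine (B8Ineq170.norm_mul_sub_one_le_of_norm_le_one h1).trans (add_le_add ?_ ?_)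
    · exact (norm_inv_sub_one_le (hW _ _)).trans (hB (q - e κ) κ (hqm.trans hstep) (by rw [sub_add_cancel]; exact hq))
    · have hq' : q - e κ ≤ hi := le_trans (fun i => by simp only [Pi.sub_apply, e_apply]; split_ifs <;> omega) hq
      have := seg_walk_bwd W hW hB κ m (q - e κ) (by rw [hq1]; exact hqm) hq'
      simpa only [B7Prop1Explicit.Letter.vec_false, ← sub_eq_add_neg] using this

/-- Segment walk of either sign inside the box: `‖W([q, q + n e_κ]) − 1‖ ≤ |n|·b` for `q`, `q + n e_κ ∈ [lo, hi]`. [folklore] -/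
theorem seg_walk_int (W : Site d → Fin d → 𝔸ˣ) (hW : ∀ x κ, W x κ ∈ U1 𝔸) {lo hi : Site d} {b : ℝ}
    (hB : ∀ (z : Site d) (κ : Fin d), lo ≤ z → z + e κ ≤ hi → ‖((W z κ : 𝔸ˣ) : 𝔸) - 1‖ ≤ b) (κ : Fin d) (n : ℤ) (q : Site d)
    (hq : lo ≤ q) (hq' : q ≤ hi) (hn : lo ≤ q + n • e κ) (hn' : q + n • e κ ≤ hi) :
    ‖((hol W q (seg κ n) : 𝔸ˣ) : 𝔸) - 1‖ ≤ (n.natAbs : ℝ) * b := by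
  cases n with
  | ofNat m =>
    rw [Int.ofNat_eq_natCast, seg_natCast, Int.natAbs_natCast]
    exact seg_walk_fwd W hW hB κ m q hq (by exact_mod_cast hn')
  | negSucc m =>
    have hneg : q + Int.negSucc m • e κ = q - ((m + 1 : ℕ) : ℤ) • e κ := by
      rw [Int.negSucc_eq, neg_smul, sub_eq_add_neg]; push_cast; rfl
    rw [hneg] at hn
    rw [show seg κ (Int.negSucc m) = List.replicate (m + 1) (κ, false) from rfl, Int.natAbs_negSucc]
    exact seg_walk_bwd W hW hB κ (m + 1) q hn hq'

/-- Tree walk over a duplicate-free list of directions inside the box: from `q ∈ [lo, hi]`, walking the coordinates `v_κ`, `κ ∈ ks`, with every target coordinate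
`q_κ + v_κ ∈ [lo_κ, hi_κ]`, the holonomy stays within `(Σ_{κ∈ks} |v_κ|)·b` of `1`. [folklore] -/
theorem tw_walk_box (W : Site d → Fin d → 𝔸ˣ) (hW : ∀ x κ, W x κ ∈ U1 𝔸) {lo hi : Site d} {b : ℝ}
    (hB : ∀ (z : Site d) (κ : Fin d), lo ≤ z → z + e κ ≤ hi → ‖((W z κ : 𝔸ˣ) : 𝔸) - 1‖ ≤ b) :
    ∀ (ks : List (Fin d)), ks.Nodup → ∀ (v q : Site d), lo ≤ q → q ≤ hi → (∀ κ ∈ ks, lo κ ≤ q κ + v κ ∧ q κ + v κ ≤ hi κ) →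
      ‖((hol W q (tw ks v) : 𝔸ˣ) : 𝔸) - 1‖ ≤ (ks.map fun κ => ((v κ).natAbs : ℝ) * b).sum
  | [], _, v, q, _, _, _ => by simp
  | κ :: ks, hks, v, q, hq, hq', hv => by
    have hκ : κ ∉ ks := (List.nodup_cons.mp hks).1
    have hks' : ks.Nodup := (List.nodup_cons.mp hks).2
    -- the end point of the first segment lies in the box
    have hn : lo ≤ q + v κ • e κ := fun i => by
      simp only [Pi.add_apply, zsmul_e_apply]
      split_ifs with h
      · subst h; exact (hv i (by simp)).1
      · rw [add_zero]; exact hq i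
    have hn' : q + v κ • e κ ≤ hi := fun i => by
      simp only [Pi.add_apply, zsmul_e_apply]
      split_ifs with h
      · subst h; exact (hv i (by simp)).2
      · rw [add_zero]; exact hq' i
    rw [tw_cons, hol_append, Units.val_mul, disp_seg, List.map_cons, List.sum_cons]
    have h1 : ‖((hol W q (seg κ (v κ)) : 𝔸ˣ) : 𝔸)‖ ≤ 1 := (mem_U1.mp (hol_mem hW _ _)).1
    refine (B8Ineq170.norm_mul_sub_one_le_of_norm_le_one h1).trans (add_le_add (seg_walk_int W hW hB κ (v κ) q hq hq' hn hn') ?_)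
    refine tw_walk_box W hW hB ks hks' v (q + v κ • e κ) hn hn' (fun κ' hκ' => ?_)
    have hne : κ' ≠ κ := fun h => hκ (h ▸ hκ')
    simp only [Pi.add_apply, zsmul_e_apply, if_neg hne, add_zero]
    exact hv κ' (List.mem_cons_of_mem κ hκ')

/-- ★★★ **NON-ABELIAN STOKES FOR A TREE-AXIAL FIELD ON A BOX** — for a `U1`-valued `W`, tree-axial at `lo` on `[lo, hi]`, with plaquettes within `p` there, and ANY two box
points `y, z`: `‖W(Γ_{y,z}) − 1‖ ≤ |z − y|₁ · (|hi − lo|₁ · p)` (the comb path `Γ_{y,z}` stays in the box; each of its `|z − y|₁` bonds is within `|hi − lo|₁·p` of `1` by §2;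
products in `U1`). [cite: Balaban1985Averaging, pp.24–25] -/
theorem norm_axialFn_sub_one_le_of_treeAxial (W : Site d → Fin d → 𝔸ˣ) (hW : ∀ x κ, W x κ ∈ U1 𝔸) {lo hi : Site d} {p : ℝ} (hp : 0 ≤ p) (hP : PlaqSmall W lo hi p)
    (hT : ∀ (x : Site d) (ν : Fin d), lo ≤ x → x + e ν ≤ hi → lowPart ν (x - lo) = 0 → W x ν = 1)
    {y z : Site d} (hy : lo ≤ y) (hy' : y ≤ hi) (hz : lo ≤ z) (hz' : z ≤ hi) :
    ‖((axialFn W y z : 𝔸ˣ) : 𝔸) - 1‖ ≤ l1 (z - y) * (l1 (hi - lo) * p) := by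
  have hB := fun x μ hlo hhi => norm_bond_sub_one_le_of_treeAxial' W hW hp hP hT x μ hlo hhi
  have hw := tw_walk_box W hW hB (List.finRange d).reverse (List.nodup_reverse.mpr (List.nodup_finRange d)) (z - y) y hy hy'
    (fun κ _ => by simp only [Pi.sub_apply, add_sub_cancel]; exact ⟨hz κ, hz' κ⟩)
  rw [← treeWord_eq_tw] at hw
  refine hw.trans (le_of_eq ?_)
  rw [List.map_reverse, List.sum_reverse, ← Fin.sum_univ_def, ← Finset.sum_mul]
  simp only [l1, Nat.cast_sum]

end Summit.QuantumFields.YangMills.Theorems.HalvingTreeAxialStokes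

end
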